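import Summits.BirchSwinnertonDyer.Rank1Residual.F1Sign2.MinusHalfSumAwayClosedFormProofs
import HarnessLib

/-!
# Cell `bsd-f1-sign2`, AN-33k/l/m PROOFS AWAY FROM `M` (§8♯): the full twisted Birch sum mod `4u` and the non-vanishing corollaries for symbol units away from `M` — KERNEL-CHECKED (-an g16, Sketch_v37 §8)

PORT (cell `bsd-f1-sign2`, seat `-ty` g11) of -an g16's tree-rebased file of record `MEMO-an-data/g16/Sketch_v37.lean` 454eaaa5b944aeb6 (= MEMO-an v1.40 /
`Sketch_v36.lean` 335ae8cb61bfaf5b rebased on the tree: imports `F1Sign2/UnitDoorParityAtTwo` + `F1Sign2/TwistedMinusSymbolSumProofs`, the 37 decls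
byte-identical in the tree deleted, the v32-generalised «units AWAY from M» helpers renamed `…_away`; farm rc 0 · 0 err · 0 warn · 0 sorry,
`bc/Sketch_v37_check.json` 6d9656a1424da834; evidence #60 on stmt-23715).  REF1 §126 (refuter-bsd-f1-sign2-ref1 g11, 2026-08-28T17:18:39Z): «§4–§10 Away
generalisation clean; 29/29 new theorems axioms {propext, Classical.choice, Quot.sound}».  Typer edits = this header, the section ranges, added
docstrings on undocumented helpers; proofs VERBATIM.  Nothing here proves BSD; 23715 not closed.
Section §8 of the port file: `ratMinusTwistedSymbolSum_eq_two_mul_unitsHalfSum_away`, `twistedMinusSymbolSum_unitClassLaw` (AN-33k away from `M`),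
`twistedLValue_one_ne_zero_of_pureCycle_away` (AN-33l), `entireLFunction_quadraticTwist_one_ne_zero_of_pureCycle_away` (AN-33m) with helpers;
imports §6♯–§7♯; the tree's §8 special versions (p649174) stay.  Placement (REF2 v35 §1): statement NOT IN PRINT (fills A–N–S 2026 Table 1 row (12) /
Zhai 2021 Rem 1.4 cell), NEW-COMBINATION-small, kernel-checked, beyond-print no.
[cite: AdachiNomotoShii2026, Thm. 4.1, Rem. 4.5] [cite: Zhai2025, Rem. 1.4] [cite: MazurTate1987, §1]
-/

set_option autoImplicit false

noncomputable section

open scoped Classical MatrixGroups ModularForm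

open CongruenceSubgroup WeierstrassCurve Literature.NumberTheory.EllipticCurves Literature.NumberTheory.EllipticCurves.ModularForms

namespace Summit.BirchSwinnertonDyer.Rank1Residual.F1Sign2.ANg16

/-! ## 8. (v28) AN-33k: the full twisted Birch sum `mod 4u` and the non-vanishing corollary -/

section TwistedSum

open Finset

variable {N : ℕ} [NeZero N] (f : CuspForm (Gamma0 N) 2)

/-- **AN-33k (symbol half).**  For an odd `m = 2h+1`, a symbol unit `u`, an ODD Dirichlet character `χ mod m` with INTEGER values
(`χ(k) = c k`) that are ODD on the units `k ≤ h` (e.g. any odd quadratic character: `c k = ±1`):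
`Σ_{a mod m} χ(a)[a/m]⁻_f = 2·F×_m + 4zu` for some `z ∈ ℤ`, where `F×_m = Σ_{k ≤ h, (k,m)=1} [k/m]⁻_f`. -/
theorem ratMinusTwistedSymbolSum_eq_two_mul_unitsHalfSum_away {M : ℕ} {u : ℚ} (hu : IsMinusSymbolUnitAway f M u) (h : ℕ) {m : ℕ}
    [NeZero m] (hmh : m = 2 * h + 1) (hmM : m.Coprime M) (χ : DirichletCharacter ℂ m) (hχo : χ.Odd) (c : ℕ → ℤ) (hc : ∀ k : ℕ, χ (k : ZMod m) = (c k : ℂ))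
    (hodd : ∀ k ∈ Icc 1 h, Nat.Coprime k m → Odd (c k)) :
    ∃ z : ℤ, ratMinusTwistedSymbolSum f χ = (((2 : ℚ) * minusHalfSumUnits f m + 4 * z * u : ℚ) : ℂ) := by
  -- (1) integer bookkeeping of `c`: `c (m - k) = - c k` (oddness) and `c k = 0` off the units
  have hrefl : ∀ k ∈ Icc 1 h, c (2 * h + 1 - k) = - c k := by
    intro k hk
    rw [mem_Icc] at hk
    have h1 : (((2 * h + 1 - k : ℕ) : ZMod m)) = - (k : ZMod m) := by
      rw [Nat.cast_sub (by omega), ← hmh, ZMod.natCast_self, zero_sub]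
    have h2 : χ (-(k : ZMod m)) = - χ (k : ZMod m) := by
      rw [neg_eq_neg_one_mul ((k : ZMod m)), map_mul, hχo]; ring
    have h3 : (c (2 * h + 1 - k) : ℂ) = ((-c k : ℤ) : ℂ) := by
      rw [← hc, h1, h2, hc]; push_cast; ring
    exact_mod_cast h3
  have hzero : ∀ k ∈ Icc 1 h, ¬ Nat.Coprime k m → c k = 0 := by
    intro k hk hcop
    have hnu : ¬ IsUnit (k : ZMod m) := by rwa [ZMod.isUnit_iff_coprime]
    have h3 : (c k : ℂ) = ((0 : ℤ) : ℂ) := by rw [← hc, MulChar.map_nonunit χ hnu]; simp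
    exact_mod_cast h3
  -- (2) the symbol sum in `ℚ`
  rw [ratMinusTwistedSymbolSum_eq_sum_Icc f h hmh χ c hc, sum_weight_mul_ratMinusSymbol]
  obtain ⟨hu0, hu⟩ := hu
  have hu' : ∀ k : ℕ, ∃ z : ℤ, ratMinusSymbol f ((k : ℚ) / ((2 * h + 1 : ℕ) : ℚ)) = z * u := fun k =>
    hu _ (den_natCast_div_natCast_coprime (by rw [← hmh]; exact hmM) k)
  choose Z hZ using hu'
  have hpt : ∀ k ∈ Icc 1 h,
      ∃ z : ℤ, ((c k - c (2 * h + 1 - k) : ℤ) : ℚ) * ratMinusSymbol f ((k : ℚ) / ((2 * h + 1 : ℕ) : ℚ)) -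
        2 * (if Nat.Coprime k m then ratMinusSymbol f ((k : ℚ) / ((2 * h + 1 : ℕ) : ℚ)) else 0) = 2 * z * (2 * u) := by
    intro k hk
    rw [hrefl k hk]
    by_cases hcop : Nat.Coprime k m
    · obtain ⟨w, hw⟩ := hodd k hk hcop
      rw [if_pos hcop, hZ, hw]
      exact ⟨w * Z _, by push_cast; ring⟩
    · rw [if_neg hcop, hzero k hk hcop]
      exact ⟨0, by push_cast; ring⟩
  obtain ⟨z, hz⟩ := exists_int_sum_sub_sum (Icc 1 h) _ _ hpt
  refine ⟨z, ?_⟩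
  have hF : minusHalfSumUnits f m = ∑ k ∈ Icc 1 h, (if Nat.Coprime k m then ratMinusSymbol f ((k : ℚ) / ((2 * h + 1 : ℕ) : ℚ)) else 0) := by
    unfold minusHalfSumUnits
    rw [Finset.sum_filter, hmh, show (2 * h + 1 - 1) / 2 = h from by omega]
  rw [← mul_sum] at hz
  congr 1
  rw [hF]
  linear_combination hz

end TwistedSum

section TwistedValue

open scoped NumberTheorySymbols

open Finset Literature.NumberTheory.QuadraticFields

variable {N : ℕ} [NeZero N] (f : CuspForm (Gamma0 N) 2)

/-- (v32) AN-33k for units away from `M` (internal form; the landed statement is the case `M = 1`). -/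
theorem twistedMinusSymbolSum_unitClassLaw (hf : IsNewform0 f) (hQ : coeffField f = ⊥) {M : ℕ} {u : ℚ}
    (hu : IsMinusSymbolUnitAway f M u) {q₀ : ℕ} {a₀ : ℤ} (hq₀ : q₀.Prime) (hq₀o : Odd q₀) (hq₀N : ¬ q₀ ∣ N) (hq₀M : q₀.Coprime M)
    (ha₀ : cuspCoeff f q₀ = (a₀ : ℂ)) (ha₀o : Odd a₀) (a : ℕ → ℤ) {m : ℕ} [NeZero m] (hsq : Squarefree m) (hmo : Odd m)
    (hmM : m.Coprime M) (hpr : ∀ q ∈ m.primeFactors, ¬ q ∣ N ∧ cuspCoeff f q = (a q : ℂ))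
    (χ : DirichletCharacter ℂ m) (hχo : χ.Odd) (hq : ∀ x : (ZMod m)ˣ, χ x = 1 ∨ χ x = -1) :
    ((1 < m ∧ ∀ q ∈ m.primeFactors, Odd (a q)) →
        ∃ z : ℤ, ratMinusTwistedSymbolSum f χ = (((2 : ℚ) * minusHalfSum f q₀ + 4 * z * u : ℚ) : ℂ)) ∧
    (¬ (1 < m ∧ ∀ q ∈ m.primeFactors, Odd (a q)) →
        ∃ z : ℤ, ratMinusTwistedSymbolSum f χ = (((4 : ℚ) * z * u : ℚ) : ℂ)) := by
  obtain ⟨c, hc, hcodd⟩ := exists_intLift_of_quadratic χ hq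
  obtain ⟨h, hmh⟩ := hmo
  have hmh' : m = 2 * h + 1 := by omega
  obtain ⟨z₁, hz₁⟩ := ratMinusTwistedSymbolSum_eq_two_mul_unitsHalfSum_away f hu h hmh' hmM χ hχo c hc
    (fun k _ hk => hcodd k hk)
  have hj := minusHalfSumUnits_closedForm_modTwo_away f hf hQ hu hq₀ hq₀o hq₀N hq₀M ha₀ ha₀o a m hsq ⟨h, hmh⟩ hmM hpr
  refine ⟨fun hpure => ?_, fun hnp => ?_⟩
  · obtain ⟨z₂, hz₂⟩ := hj.1 hpure
    refine ⟨z₁ + z₂, ?_⟩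
    rw [hz₁, hz₂]; push_cast; ring
  · obtain ⟨z₂, hz₂⟩ := hj.2 hnp
    refine ⟨z₁ + z₂, ?_⟩
    rw [hz₁, hz₂]; push_cast; ring

/-- **AN-33l: NON-VANISHING of `L(f, χ̄, 1)` on the whole pure-`3`-cycle family from one bit.**  If `η_f = 1`
(`F_{q₀} = (2z₀+1)u` at one — hence every — `3`-cycle prime `q₀ ∤ N`), then for every square-free odd `m > 1` coprime to `N`
whose prime factors are all `3`-cycle primes (`a_q` odd) and every odd primitive quadratic character `χ mod m`, the entire
continuation `L` of `L(f, χ̄, s)` has `L(1) ≠ 0`.  (Birch: `Σ·Ω⁻·i = τ(χ)·L(1)` with `Σ ≡ 2u (mod 4u)`, `Ω⁻ > 0`.) -/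
theorem twistedLValue_one_ne_zero_of_pureCycle_away (hf : IsNewform0 f) (hQ : coeffField f = ⊥) {u : ℚ} (hu : IsMinusSymbolUnitAway f N u)
    {q₀ : ℕ} {a₀ : ℤ} (hq₀ : q₀.Prime) (hq₀o : Odd q₀) (hq₀N : ¬ q₀ ∣ N) (ha₀ : cuspCoeff f q₀ = (a₀ : ℂ)) (ha₀o : Odd a₀)
    (hη : ∃ z₀ : ℤ, minusHalfSum f q₀ = (2 * z₀ + 1) * u)
    (a : ℕ → ℤ) {m : ℕ} [NeZero m] (hsq : Squarefree m) (hmo : Odd m) (hm1 : 1 < m)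
    (hpr : ∀ q ∈ m.primeFactors, ¬ q ∣ N ∧ cuspCoeff f q = (a q : ℂ)) (hpure : ∀ q ∈ m.primeFactors, Odd (a q))
    {χ : DirichletCharacter ℂ m} (hχ : χ.IsPrimitive) (hχo : χ.Odd) (hq : ∀ x : (ZMod m)ˣ, χ x = 1 ∨ χ x = -1)
    {L : ℂ → ℂ} (hL : Differentiable ℂ L) (hL' : ∀ s : ℂ, 2 < s.re → L s = twistedLSeries f χ⁻¹ s) :
    L 1 ≠ 0 := by
  obtain ⟨z, hz⟩ := (twistedMinusSymbolSum_unitClassLaw f hf hQ hu hq₀ hq₀o hq₀N ((Nat.Prime.coprime_iff_not_dvd hq₀).mpr hq₀N)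
    ha₀ ha₀o a hsq hmo (coprime_of_primeFactors_not_dvd (NeZero.ne m) fun q hq' => (hpr q hq').1) hpr χ hχo hq).1 ⟨hm1, hpure⟩
  obtain ⟨z₀, hz₀⟩ := hη
  have hB := ratMinusTwistedSymbolSum_mul_minusPeriod_mul_I f hf hQ hχ hχo hL hL'
  have hΩ : 0 < minusPeriod f := IsNewform0.minusPeriod_pos_holds hf hQ
  have hS : ratMinusTwistedSymbolSum f χ ≠ 0 := by
    rw [hz, hz₀]
    have hq' : (2 : ℚ) * ((2 * z₀ + 1) * u) + 4 * z * u ≠ 0 := by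
      have : (2 : ℚ) * ((2 * z₀ + 1) * u) + 4 * z * u = (4 * (z₀ + z) + 2) * u := by ring
      rw [this]
      refine mul_ne_zero ?_ (ne_of_gt hu.1)
      intro h0
      have h1 : (4 * (z₀ + z) + 2 : ℚ) = ((4 * (z₀ + z) + 2 : ℤ) : ℚ) := by push_cast; ring
      rw [h1] at h0
      have h2 : (4 * (z₀ + z) + 2 : ℤ) = 0 := by exact_mod_cast h0
      omega
    exact_mod_cast hq'
  intro hL0
  rw [hL0, mul_zero] at hB
  have hΩ' : (minusPeriod f : ℂ) ≠ 0 := by exact_mod_cast (ne_of_gt hΩ)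
  exact (mul_ne_zero (mul_ne_zero hS hΩ') Complex.I_ne_zero) hB

/-- **AN-33m: NON-VANISHING `L(W^{(d)}, 1) ≠ 0` at every pure-`3`-cycle door of an `η = 1` curve** (W-level reading of AN-33l
through the tree's signed Birch formula `ratMinusTwistedSymbolSum_jacobiChar_mul_minusPeriod` and the twist coefficients
`LFunction_quadraticTwist_apply_of_int_gcd_eq_one`; modularity enters as `hasEntireLFunction_rat` + `IsNewformOf W f`).
For `W/ℚ` with newform `f`, a symbol unit `u` with `η_f = 1` (`F_{q₀} ∈ (2ℤ+1)u` at a `3`-cycle prime `q₀ ∤ N`), and a door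
`d < 0`, `d ≡ 1 (mod 4)` square-free with `(d, N_W) = 1` all of whose prime factors `q` satisfy `q ∤ N`, `a_q(f)` odd:
`L(W^{(d)}, 1) ≠ 0`. -/
theorem entireLFunction_quadraticTwist_one_ne_zero_of_pureCycle_away (hE : hasEntireLFunction_rat)
    (W : WeierstrassCurve ℚ) [W.IsElliptic] (hfW : IsNewformOf W f) {u : ℚ} (hu : IsMinusSymbolUnitAway f N u)
    {q₀ : ℕ} {a₀ : ℤ} (hq₀ : q₀.Prime) (hq₀o : Odd q₀) (hq₀N : ¬ q₀ ∣ N) (ha₀ : cuspCoeff f q₀ = (a₀ : ℂ)) (ha₀o : Odd a₀)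
    (hη : ∃ z₀ : ℤ, minusHalfSum f q₀ = (2 * z₀ + 1) * u)
    (a : ℕ → ℤ) {d : ℤ} (hd0 : d < 0) (hsq : Squarefree d) (hd4 : d % 4 = 1) (hgcd : Int.gcd d (W.conductorNorm ℤ) = 1)
    (hpr : ∀ q ∈ d.natAbs.primeFactors, ¬ q ∣ N ∧ cuspCoeff f q = (a q : ℂ)) (hpure : ∀ q ∈ d.natAbs.primeFactors, Odd (a q)) :
    (W.quadraticTwist (d : ℚ)).entireLFunction 1 ≠ 0 := by
  set D : ℕ := d.natAbs with hDdef
  haveI : NeZero D := ⟨Int.natAbs_ne_zero.mpr hsq.ne_zero⟩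
  have hDd : (D : ℤ) = -d := by rw [hDdef]; omega
  have hD3 : D % 4 = 3 := by omega
  have hDsq : Squarefree D := Int.squarefree_natAbs.mpr hsq
  have hDodd : Odd D := Nat.odd_iff.mpr (by omega)
  have hD1 : 1 < D := by omega
  have hdq : (d : ℚ) ≠ 0 := by exact_mod_cast hsq.ne_zero
  haveI := W.isElliptic_quadraticTwist hdq
  have hEt : (W.quadraticTwist (d : ℚ)).HasEntireLFunction := hE _
  have hco : ∀ n : ℕ, (((W.quadraticTwist (d : ℚ)).LFunction n : ℤ) : ℂ) = jacobiChar D n * cuspCoeff f n := fun n ↦ by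
    rw [LFunction_quadraticTwist_apply_of_int_gcd_eq_one W hd4 hsq hgcd n, Int.cast_mul, jacobiChar_natCast, hfW.2 n]
  have hL' : ∀ s : ℂ, 2 < s.re → (W.quadraticTwist (d : ℚ)).entireLFunction s = twistedLSeries f (jacobiChar D) s := by
    intro s hs
    rw [(W.quadraticTwist (d : ℚ)).entireLFunction_eq_LSeries hEt (by linarith)]
    unfold WeierstrassCurve.LSeries twistedLSeries
    congr 1
    funext n
    exact hco n
  have hB := ratMinusTwistedSymbolSum_jacobiChar_mul_minusPeriod hfW.1 hfW.coeffField_eq_bot hDsq hD3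
    ((W.quadraticTwist (d : ℚ)).differentiable_entireLFunction hEt) hL'
  -- the Jacobi character is odd and quadratic
  have hχo : (jacobiChar D).Odd := jacobiChar_neg_one_of_mod_four_eq_three hD3
  have hq : ∀ x : (ZMod D)ˣ, jacobiChar D x = 1 ∨ jacobiChar D x = -1 := by
    intro x
    rcases isQuadratic_jacobiChar (q := D) (x : ZMod D) with h0 | h1 | h2
    · exact absurd ((Units.isUnit x).map (jacobiChar D)) (by rw [h0]; exact not_isUnit_zero)
    · exact Or.inl h1
    · exact Or.inr h2
  -- AN-33k at the pure level `D`
  obtain ⟨z, hz⟩ := (twistedMinusSymbolSum_unitClassLaw f hfW.1 hfW.coeffField_eq_bot hu hq₀ hq₀o hq₀N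
    ((Nat.Prime.coprime_iff_not_dvd hq₀).mpr hq₀N) ha₀ ha₀o a hDsq hDodd
    (coprime_of_primeFactors_not_dvd (NeZero.ne D) fun q hq' => (hpr q hq').1) hpr (jacobiChar D) hχo hq).1 ⟨hD1, hpure⟩
  obtain ⟨z₀, hz₀⟩ := hη
  have hS : ratMinusTwistedSymbolSum f (jacobiChar D) ≠ 0 := by
    rw [hz, hz₀]
    have hq' : (2 : ℚ) * ((2 * z₀ + 1) * u) + 4 * z * u ≠ 0 := by
      have : (2 : ℚ) * ((2 * z₀ + 1) * u) + 4 * z * u = (4 * (z₀ + z) + 2) * u := by ring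
      rw [this]
      refine mul_ne_zero ?_ (ne_of_gt hu.1)
      intro h0
      have h1 : (4 * (z₀ + z) + 2 : ℚ) = ((4 * (z₀ + z) + 2 : ℤ) : ℚ) := by push_cast; ring
      rw [h1] at h0
      have h2 : (4 * (z₀ + z) + 2 : ℤ) = 0 := by exact_mod_cast h0
      omega
    exact_mod_cast hq'
  have hΩ' : (minusPeriod f : ℂ) ≠ 0 := by
    exact_mod_cast (ne_of_gt (IsNewform0.minusPeriod_pos_holds hfW.1 hfW.coeffField_eq_bot))
  intro hL0
  rw [hL0, mul_zero] at hB
  exact (mul_ne_zero hS hΩ') hB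

end TwistedValue

end Summit.BirchSwinnertonDyer.Rank1Residual.F1Sign2.ANg16
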